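import Summits.QuantumFields.YangMills.Theses.LangevinControlUV
import Literature.MathematicalPhysics.QuantumFieldTheory.MassGapFromLatticeClustering

/-!
# Lead prover's restatement evidence for crux `GapToContinuum` (stmt-QuantumFields-8896)

This file ELABORATES (rc 0, 0 sorries) and records, for the tenure planner of
`route-QuantumFields-LangevinControlUV`, the restatement the line lead recommends after both
checked lines (`HeavyLemma`, `Sketch`) died at the same stub (see `Lines/Sketch.dead.md`,
`Lines/HeavyLemma.dead.md`):

* `GapToContinuumCS` — the crux with the tree's NORM-FORM lattice hypothesis
  `SpeciesScheme.HasCSClustering` (file `Literature/MathematicalPhysics/QuantumFieldTheory/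
  MassGapFromLatticeClustering.lean`, whose module docstring says verbatim that `ClustersCS`
  "replaces hypotheses of the form `HasLatticeMassGap` (per-pair `∃ C` before `∀ᶠ k`, local
  observables, lattice times), which do not pass to the limit") in place of `HasLatticeMassGap`;
  it is CLOSED by the tree theorem `IsYangMillsFor.hasMassGap_of_hasCSClustering`
  (`gapToContinuumCS_holds` below, one line).
* `OSLegsAtWeakCouplingCS` — the OS-legs crux `OSLegsAtWeakCouplingC` (stmt-QuantumFields-16207)
  with its conclusion extended by `∧ sch.HasCSClustering r Δ` inside the final `∃ Δ > 0`: the place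
  where the scheme `sch` is EXISTENTIAL, so that per-pair clustering constants can be absorbed by the
  choice of `L_k` (diagonalisation over a countable dense family of slab-ordered test data) and the
  odd-torus reflection positivity (`wilsonExpectation_oddReflectionPositive`, needs `0 ≤ β`) is
  available from `sch.HasWeakCouplingLimit`.
* `closes_restated` — the route's deciding theorem re-proved with these two changes: the assembly
  becomes `FemtoCurvatureTwoPointC → FemtoCurvatureSkewnessC → LatticeGapInUVUnitsC →
  OSLegsAtWeakCouplingCS → YangMills` (four cruxes; `GapToContinuum` is discharged by the tree).

Nothing here is proposed to the tree; it is evidence attached to the crux item.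
-/

namespace Summit.QuantumFields.YangMills.Cruxes.GapToContinuum.Lead

open Literature.MathematicalPhysics.QuantumFieldTheory
open Summit.QuantumFields.YangMills.Theses.LangevinControlUV

/-- **R1 (restated crux).** `IsYangMillsFor r sch T` and the norm-form Cauchy–Schwarz clustering
of the lattice `n`-point functions on the scheme's own tori (`sch.HasCSClustering r Δ`) give the
full-spectrum gap `T.HasMassGap Δ`. -/
def GapToContinuumCS : Prop :=
  ∀ (G : Type) [Group G] [TopologicalSpace G] [IsTopologicalGroup G] [CompactSpace G]
    [MeasurableSpace G] [BorelSpace G] (r : LatticeRep G) (sch : SpeciesScheme (YMSpecies G))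
    (T : OSData (YMSpecies G) 4) (Δ : ℝ), 0 < Δ → IsYangMillsFor r sch T →
      sch.HasCSClustering r Δ → T.HasMassGap Δ

/-- R1 is a theorem of the tree (`MassGapFromLatticeClustering`). -/
theorem gapToContinuumCS_holds : GapToContinuumCS :=
  fun _G _ _ _ _ _ _ _r _sch _T _Δ _ hYM hCS => hYM.hasMassGap_of_hasCSClustering hCS

/-- **R2 (restated OS legs).** Verbatim `OSLegsAtWeakCouplingC` (stmt-QuantumFields-16207) with the
conclusion's last conjunct `∃ Δ > 0, HasLatticeMassGap r sch Δ` extended to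
`∃ Δ > 0, HasLatticeMassGap r sch Δ ∧ sch.HasCSClustering r Δ`. -/
def OSLegsAtWeakCouplingCS : Prop :=
  open Literature.MathematicalPhysics.QuantumFieldTheory in ∀ (G : Type) [Group G] [TopologicalSpace G] [IsTopologicalGroup G] [CompactSpace G], IsCompactSimpleLieGroup G → letI : MeasurableSpace G := borel G; haveI : BorelSpace G := ⟨rfl⟩; ∀ (r : LatticeRep G), ∀ (a : ℝ → ℝ), Continuous a → (∃ (Γ : ℝ → ℝ) (β₀ ℓ₀ c C : ℝ), 0 < ℓ₀ ∧ 0 < c ∧ (∀ β, 0 < a β) ∧ Filter.Tendsto a Filter.atTop (nhds 0) ∧ (∀ s : ℝ, 0 < s → s ≤ ℓ₀ → 0 < Γ s ∧ Γ s ≤ 1) ∧ ∀ (L : ℕ) [NeZero L] (β : ℝ), β₀ ≤ β → (L : ℝ) * a β ≤ ℓ₀ → let P : (Fin 4 → ZMod L) → Fin 4 → Fin 4 → GaugeConfig 4 L G → ℝ := fun x i j U => (r.N : ℝ) - (r.ρ (plaquetteHolonomy U x i j)).trace.re; let E : (GaugeConfig 4 L G → ℝ) → ℝ := fun F => wilsonExpectation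 (d := 4) (L := L) r.ρ β F; let cov : (GaugeConfig 4 L G → ℝ) → (GaugeConfig 4 L G → ℝ) → ℝ := fun F F' => E (fun U => F U * F' U) - E F * E F'; let dist : (Fin 4 → ZMod L) → (Fin 4 → ZMod L) → ℝ := fun x y => Real.sqrt (∑ k : Fin 4, (((x k - y k).valMinAbs : ℤ) : ℝ) ^ 2); (∀ n : ℕ, 1 ≤ n → 8 * n ≤ L → c * Γ ((n : ℝ) * a β) ≤ (n : ℝ) ^ 8 * cov (P 0 0 1) (P (Pi.single (2 : Fin 4) ((n : ℕ) : ZMod L)) 0 1) ∧ (n : ℝ) ^ 8 * cov (P 0 0 1) (P (Pi.single (2 : Fin 4) ((n : ℕ) : ZMod L)) 0 1) ≤ C * Γ ((n : ℝ) * a β)) ∧ (∀ (x y : Fin 4 → ZMod L) (i j i' j' : Fin 4), x ≠ y → i ≠ j → i' ≠ j' → |cov (P x i j) (P y i' j')| * dist x y ^ 8 ≤ C * Γ (dist x y * a β))) → (∃ (Γ₃ : ℝ → ℝ) (β₁ ℓ₁ c₃ : ℝ), 0 < ℓ₁ ∧ 0 < c₃ ∧ (∀ s : ℝ, 0 < s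 → s ≤ ℓ₁ → 0 < Γ₃ s) ∧ ∀ (L : ℕ) [NeZero L] (β : ℝ), β₁ ≤ β → (L : ℝ) * a β ≤ ℓ₁ → let P : (Fin 4 → ZMod L) → Fin 4 → Fin 4 → GaugeConfig 4 L G → ℝ := fun x i j U => (r.N : ℝ) - (r.ρ (plaquetteHolonomy U x i j)).trace.re; let E : (GaugeConfig 4 L G → ℝ) → ℝ := fun F => wilsonExpectation (d := 4) (L := L) r.ρ β F; let cov : (GaugeConfig 4 L G → ℝ) → (GaugeConfig 4 L G → ℝ) → ℝ := fun F F' => E (fun U => F U * F' U) - E F * E F'; ∀ n : ℕ, 1 ≤ n → 8 * n ≤ L → c₃ * Γ₃ ((n : ℝ) * a β) ≤ (n : ℝ) ^ 12 * |E (fun U => P 0 0 1 U * P (Pi.single (2 : Fin 4) ((n : ℕ) : ZMod L)) 0 1 U * P (Pi.single (3 : Fin 4) ((n : ℕ) : ZMod L)) 0 1 U) - E (P 0 0 1) * cov (P (Pi.single (2 : Fin 4) ((n : ℕ) : ZMod L)) 0 1) (P (Pi.single (3 : Fin 4) ((n : ℕ) : ZMod L)) 0 1) - E (P (Pi.single (2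 : Fin 4) ((n : ℕ) : ZMod L)) 0 1) * cov (P 0 0 1) (P (Pi.single (3 : Fin 4) ((n : ℕ) : ZMod L)) 0 1) - E (P (Pi.single (3 : Fin 4) ((n : ℕ) : ZMod L)) 0 1) * cov (P 0 0 1) (P (Pi.single (2 : Fin 4) ((n : ℕ) : ZMod L)) 0 1) - E (P 0 0 1) * E (P (Pi.single (2 : Fin 4) ((n : ℕ) : ZMod L)) 0 1) * E (P (Pi.single (3 : Fin 4) ((n : ℕ) : ZMod L)) 0 1)|) → (∃ (c₁ β₂ : ℝ) (S₁ : ℝ → ℕ), 0 < c₁ ∧ ∀ A B : YMSpecies G, ∃ C : ℝ, ∀ β : ℝ, β₂ ≤ β → ∀ S n : ℕ, S₁ β ≤ S → n ≤ S → |latticeConnectedCorr r.ρ β (2 * S + 1) A.F B.F n| ≤ C * Real.exp (-(c₁ * a β * n))) → ∃ (sch : SpeciesScheme (YMSpecies G)) (T : OSData (YMSpecies G) 4), (∀ k, sch.a k = a (sch.β k)) ∧ sch.HasWeakCouplingLimit ∧ IsYangMillsFor r sch T ∧ T.IsNontrivial r.curvature ∧ T.IsNonGaussian r.curvature ∧ ∃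 Δ > 0, HasLatticeMassGap r sch Δ ∧ sch.HasCSClustering r Δ

/-- **The deciding theorem under the restatement**: the same proof as the route's `closes`, with
the transfer `GapToContinuum` replaced by the tree theorem
`IsYangMillsFor.hasMassGap_of_hasCSClustering`. -/
theorem closes_restated (hUV : FemtoCurvatureTwoPointC) (hSkew : FemtoCurvatureSkewnessC)
    (hIR : LatticeGapInUVUnitsC) (hOS : OSLegsAtWeakCouplingCS) : YangMills := by
  intro G _ _ _ _ hG
  letI : MeasurableSpace G := borel G
  haveI : BorelSpace G := ⟨rfl⟩
  obtain ⟨r⟩ := hG.2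
  obtain ⟨a, ha, hPa, hSk⟩ := hSkew G hG r (hUV G hG r)
  have hCl := hIR G hG r a ha hPa
  obtain ⟨sch, T, _, hW, hYM, hNT, hNG, Δ, hΔ, hlat, hCS⟩ := hOS G hG r a ha hPa hSk hCl
  exact ⟨r, sch, T, hW, hYM, hNT, hNG, Δ, hΔ, hYM.hasMassGap_of_hasCSClustering hCS, hlat⟩

/-- The typed crux implies the restated one is NOT claimed; conversely the restated OS legs imply
the typed OS legs (drop the new conjunct). -/
theorem osLegsAtWeakCouplingC_of_CS (h : OSLegsAtWeakCouplingCS) : OSLegsAtWeakCouplingC := by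
  intro G _ _ _ _ hG r a ha hP hSk hCl
  obtain ⟨sch, T, hsch, hW, hYM, hNT, hNG, Δ, hΔ, hlat, _⟩ := h G hG r a ha hP hSk hCl
  exact ⟨sch, T, hsch, hW, hYM, hNT, hNG, Δ, hΔ, hlat⟩

end Summit.QuantumFields.YangMills.Cruxes.GapToContinuum.Lead
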